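import Mathlib
import Summits.Ventures.HodgeRepro2.Tier7.Line3.LevelInvariantOrbital

/-!
# Tier7/Line3/CongruenceSubgroup — the principal congruence subgroups of `GL₂` over a non-archimedean field
(seat t7-x1, gen 3; STAGE 1 of the joint `arith` — crit-2's record (a) on LevelFactorData p693194, STATUS l. 15678)

LINE 3 (t7-plan-3), version (ii). L1-p5's `KappaDataFinLocal` states the level-`N` support at `v₁` on `2 × 2` MATRICES over
the completion `E_w` («some torus translate of `γ` is `γ₀_w · k` with `k ≡ 1 mod q⁻¹ ^ N`», entries bounded by a
non-archimedean absolute value `abv`), while x1's `LevelInvariantOrbital` / `LevelFactorData` state it on an abstract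
group `G` with a subgroup tower `K N` normalised by the torus (`InSupport ιA ιB γ₀ (K N) γ`). This module supplies the
GROUP-THEORETIC half of the identification, Mathlib only: over a field `F` with a non-archimedean absolute value, the
PRINCIPAL CONGRUENCE SUBGROUP of radius `r` (`0 ≤ r < 1`)
`K_r = {g ∈ GL₂(F) | every entry of g − 1 has absolute value ≤ r}`
is a SUBGROUP of `GL (Fin 2) F` (`congruenceSubgroup`; closure under products from the ultrametric inequality, under
inverses because `|det g − 1| ≤ r < 1` forces `|det g| = 1`, so `g⁻¹ = (det g)⁻¹ · adj g` is integral and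
`g⁻¹ − 1 = −g⁻¹(g − 1)`), it is NORMALISED by every integral matrix with integral inverse (`normalizes_of_integral`,
`normalizes_congruenceSubgroup`: the `Normalizes ιB (K N)` hypothesis of the level tower for any torus inside `GL₂(𝓞)`),
it is ANTITONE in `r` (`congruenceSubgroup_mono`), and a tower with radii `→ 0` has intersection `{1}`
(`eq_one_of_forall_mem`: the `hK1` hypothesis of LevelFactorPositive). The LEVEL TOWER `K N := K_{q⁻¹ ^ (N+1)}`
(`levelTower`; the index shift keeps every radius `< 1` — `q⁻¹ ^ 0 = 1` is not a subgroup of `GL₂`) is antitone with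
`⋂ = {1}` (`levelTower_antitone`, `eq_one_of_forall_mem_levelTower`) and normalised by any hom into the integral matrices
with integral inverses (`normalizes_levelTower`). STAGE 2 (a later module) identifies `InSupport` over
`GL (Fin 2) E_w` with the tori `A` (norm-one diagonal) and `B` (acting on the second basis by norm-one scalars) with
`KappaDataFinLocal`'s `IsTranslate` shape. DICTIONARY (in words): `F = E_{w}` at the inert `v₁`, `abv = |·|_{v₁}`,
`r = q⁻¹ ^ (N+1)` ↔ «`k ≡ 1 mod 𝔭^{N+1}`». Nothing here is about (N), (P), the real `X`, or HC_CM; §8(d): NO.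
Blind lane: Mathlib + the HodgeRepro2 prefix; no sorry; axioms ⊆ {propext, Classical.choice, Quot.sound}.
-/

namespace Summit.Ventures.HodgeRepro2.Tier7.Line3.CongruenceSubgroup

open Matrix

variable {F : Type*} [Field F] (abv : AbsoluteValue F ℝ)

/-! ## Entrywise bounds -/

/-- every entry of `m` has absolute value `≤ r`. -/
def EntryLE (r : ℝ) (m : Matrix (Fin 2) (Fin 2) F) : Prop := ∀ i j, abv (m i j) ≤ r

/-- the zero matrix. -/
theorem entryLE_zero {r : ℝ} (hr : 0 ≤ r) : EntryLE abv r (0 : Matrix (Fin 2) (Fin 2) F) := by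
  intro i j
  simp [hr]

/-- the identity matrix is integral. -/
theorem entryLE_one : EntryLE abv 1 (1 : Matrix (Fin 2) (Fin 2) F) := by
  intro i j
  rw [Matrix.one_apply]
  split_ifs <;> simp

/-- monotonicity in the radius. -/
theorem EntryLE.mono {r s : ℝ} (hrs : r ≤ s) {m : Matrix (Fin 2) (Fin 2) F} (hm : EntryLE abv r m) :
    EntryLE abv s m :=
  fun i j => (hm i j).trans hrs

/-- negation. -/
theorem EntryLE.neg {r : ℝ} {m : Matrix (Fin 2) (Fin 2) F} (hm : EntryLE abv r m) : EntryLE abv r (-m) := by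
  intro i j
  rw [Matrix.neg_apply, abv.map_neg]
  exact hm i j

/-- sums (ultrametric). -/
theorem EntryLE.add (hna : IsNonarchimedean abv) {r : ℝ} {m n : Matrix (Fin 2) (Fin 2) F} (hm : EntryLE abv r m) (hn : EntryLE abv r n) :
    EntryLE abv r (m + n) := by
  intro i j
  rw [Matrix.add_apply]
  exact (hna _ _).trans (max_le (hm i j) (hn i j))

/-- products (ultrametric): entries of `m * n` are bounded by `r * s`. -/
theorem EntryLE.mul (hna : IsNonarchimedean abv) {r s : ℝ} (hr : 0 ≤ r) {m n : Matrix (Fin 2) (Fin 2) F} (hm : EntryLE abv r m)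
    (hn : EntryLE abv s n) : EntryLE abv (r * s) (m * n) := by
  intro i j
  rw [Matrix.mul_apply, Fin.sum_univ_two]
  refine (hna _ _).trans (max_le ?_ ?_)
  · rw [abv.map_mul]
    exact mul_le_mul (hm i 0) (hn 0 j) (abv.nonneg _) hr
  · rw [abv.map_mul]
    exact mul_le_mul (hm i 1) (hn 1 j) (abv.nonneg _) hr

/-- a matrix close to `1` is integral: `EntryLE r (g − 1)` with `r ≤ 1` gives `EntryLE 1 g`. -/
theorem EntryLE.of_sub_one (hna : IsNonarchimedean abv) {r : ℝ} (hr1 : r ≤ 1) {g : Matrix (Fin 2) (Fin 2) F} (hg : EntryLE abv r (g - 1)) :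
    EntryLE abv 1 g := by
  have h : g = (g - 1) + 1 := by abel
  rw [h]
  exact (hg.mono abv hr1).add abv hna (entryLE_one abv)

/-! ## The determinant of a matrix close to `1` -/

/-- ultrametric: `|x| < 1 ⇒ |1 + x| = 1`. -/
theorem abv_one_add_eq_one (hna : IsNonarchimedean abv) {x : F} (hx : abv x < 1) : abv (1 + x) = 1 := by
  apply le_antisymm
  · calc abv (1 + x) ≤ max (abv 1) (abv x) := hna _ _
      _ = 1 := by rw [abv.map_one]; exact max_eq_left hx.le
  · by_contra hlt
    rw [not_le] at hlt
    have h1 : abv 1 ≤ max (abv (1 + x)) (abv (-x)) := by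
      have : (1 : F) = (1 + x) + (-x) := by ring
      calc abv 1 = abv ((1 + x) + (-x)) := by rw [← this]
        _ ≤ max (abv (1 + x)) (abv (-x)) := hna _ _
    rw [abv.map_one, abv.map_neg] at h1
    have : max (abv (1 + x)) (abv x) < 1 := max_lt hlt hx
    linarith

/-- `det g − 1` in the entries of `e = g − 1`. -/
theorem det_sub_one_eq (g : Matrix (Fin 2) (Fin 2) F) :
    g.det - 1 = (g - 1) 0 0 + (g - 1) 1 1 + (g - 1) 0 0 * (g - 1) 1 1 - (g - 1) 0 1 * (g - 1) 1 0 := by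
  rw [Matrix.det_fin_two]
  simp only [Matrix.sub_apply, Matrix.one_apply_eq, Matrix.one_apply_ne (show (0 : Fin 2) ≠ 1 by decide),
    Matrix.one_apply_ne (show (1 : Fin 2) ≠ 0 by decide), sub_zero]
  ring

/-- for `g` close to `1` (radius `r ≤ 1`), `|det g − 1| ≤ r`. -/
theorem abv_det_sub_one_le (hna : IsNonarchimedean abv) {r : ℝ} (hr0 : 0 ≤ r) (hr1 : r ≤ 1) {g : Matrix (Fin 2) (Fin 2) F}
    (hg : EntryLE abv r (g - 1)) : abv (g.det - 1) ≤ r := by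
  rw [det_sub_one_eq]
  have hrr : r * r ≤ r := mul_le_of_le_one_right hr0 hr1
  have h00 := hg 0 0
  have h11 := hg 1 1
  have h01 := hg 0 1
  have h10 := hg 1 0
  have hp1 : abv ((g - 1) 0 0 * (g - 1) 1 1) ≤ r := by
    rw [abv.map_mul]; exact (mul_le_mul h00 h11 (abv.nonneg _) hr0).trans hrr
  have hp2 : abv ((g - 1) 0 1 * (g - 1) 1 0) ≤ r := by
    rw [abv.map_mul]; exact (mul_le_mul h01 h10 (abv.nonneg _) hr0).trans hrr
  rw [sub_eq_add_neg]
  refine (hna _ _).trans (max_le ?_ ?_)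
  · exact (hna _ _).trans (max_le ((hna _ _).trans (max_le h00 h11)) hp1)
  · rw [abv.map_neg]; exact hp2

/-- for `g` close to `1` (radius `r < 1`), `|det g| = 1`. -/
theorem abv_det_eq_one (hna : IsNonarchimedean abv) {r : ℝ} (hr0 : 0 ≤ r) (hr1 : r < 1) {g : Matrix (Fin 2) (Fin 2) F}
    (hg : EntryLE abv r (g - 1)) : abv g.det = 1 := by
  have h : g.det = 1 + (g.det - 1) := by ring
  rw [h]
  exact abv_one_add_eq_one abv hna ((abv_det_sub_one_le abv hna hr0 hr1.le hg).trans_lt hr1)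

/-- the inverse of a matrix close to `1` is integral: `g⁻¹ = (det g)⁻¹ · adj g` with `|det g| = 1`. -/
theorem EntryLE.inv_of_sub_one (hna : IsNonarchimedean abv) {r : ℝ} (hr0 : 0 ≤ r) (hr1 : r < 1) (g : GL (Fin 2) F)
    (hg : EntryLE abv r ((g : Matrix (Fin 2) (Fin 2) F) - 1)) :
    EntryLE abv 1 ((g⁻¹ : GL (Fin 2) F) : Matrix (Fin 2) (Fin 2) F) := by
  have hdet : abv (g : Matrix (Fin 2) (Fin 2) F).det = 1 := abv_det_eq_one abv hna hr0 hr1 hg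
  have hint : EntryLE abv 1 (g : Matrix (Fin 2) (Fin 2) F) := hg.of_sub_one abv hna hr1.le
  rw [Matrix.coe_units_inv, Matrix.inv_def, Ring.inverse_eq_inv, Matrix.adjugate_fin_two]
  intro i j
  rw [Matrix.smul_apply, smul_eq_mul, abv.map_mul, map_inv₀, hdet, inv_one, one_mul]
  fin_cases i <;> fin_cases j
  · simpa using hint 1 1
  · simpa using hint 0 1
  · simpa using hint 1 0
  · simpa using hint 0 0

/-! ## The principal congruence subgroup -/

/-- **the principal congruence subgroup** `K_r = {g ∈ GL₂(F) | EntryLE r (g − 1)}`, `0 ≤ r < 1`. -/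
def congruenceSubgroup (hna : IsNonarchimedean abv) {r : ℝ} (hr0 : 0 ≤ r) (hr1 : r < 1) : Subgroup (GL (Fin 2) F) where
  carrier := {g | EntryLE abv r ((g : Matrix (Fin 2) (Fin 2) F) - 1)}
  one_mem' := by
    show EntryLE abv r (((1 : GL (Fin 2) F) : Matrix (Fin 2) (Fin 2) F) - 1)
    rw [Units.val_one, sub_self]
    exact entryLE_zero abv hr0
  mul_mem' := by
    intro g₁ g₂ h₁ h₂
    show EntryLE abv r (((g₁ * g₂ : GL (Fin 2) F) : Matrix (Fin 2) (Fin 2) F) - 1)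
    have hid : ((g₁ * g₂ : GL (Fin 2) F) : Matrix (Fin 2) (Fin 2) F) - 1
        = ((g₁ : Matrix (Fin 2) (Fin 2) F) - 1) * ((g₂ : Matrix (Fin 2) (Fin 2) F) - 1)
          + ((g₁ : Matrix (Fin 2) (Fin 2) F) - 1) + ((g₂ : Matrix (Fin 2) (Fin 2) F) - 1) := by
      rw [Units.val_mul]
      noncomm_ring
    rw [hid]
    have hrr : r * r ≤ r := mul_le_of_le_one_right hr0 hr1.le
    exact (((EntryLE.mul abv hna hr0 h₁ h₂).mono abv hrr).add abv hna h₁).add abv hna h₂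
  inv_mem' := by
    intro g hg
    show EntryLE abv r (((g⁻¹ : GL (Fin 2) F) : Matrix (Fin 2) (Fin 2) F) - 1)
    have hid : ((g⁻¹ : GL (Fin 2) F) : Matrix (Fin 2) (Fin 2) F) - 1
        = -(((g⁻¹ : GL (Fin 2) F) : Matrix (Fin 2) (Fin 2) F) * ((g : Matrix (Fin 2) (Fin 2) F) - 1)) := by
      have h1 : ((g⁻¹ : GL (Fin 2) F) : Matrix (Fin 2) (Fin 2) F) * (g : Matrix (Fin 2) (Fin 2) F) = 1 :=
        Units.inv_mul g
      rw [mul_sub, h1, mul_one, neg_sub]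
    rw [hid]
    have hinv : EntryLE abv 1 ((g⁻¹ : GL (Fin 2) F) : Matrix (Fin 2) (Fin 2) F) :=
      EntryLE.inv_of_sub_one abv hna hr0 hr1 g hg
    have := EntryLE.mul abv hna zero_le_one hinv hg
    rw [one_mul] at this
    exact this.neg abv

/-- membership in the congruence subgroup, by definition. -/
theorem mem_congruenceSubgroup (hna : IsNonarchimedean abv) {r : ℝ} (hr0 : 0 ≤ r) (hr1 : r < 1) (g : GL (Fin 2) F) :
    g ∈ congruenceSubgroup abv hna hr0 hr1 ↔ EntryLE abv r ((g : Matrix (Fin 2) (Fin 2) F) - 1) :=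
  Iff.rfl

/-- **normalisation by integral matrices with integral inverse**: `t⁻¹ k t − 1 = t⁻¹ (k − 1) t`. -/
theorem normalizes_of_integral (hna : IsNonarchimedean abv) {r : ℝ} (hr0 : 0 ≤ r) (hr1 : r < 1) (t : GL (Fin 2) F)
    (ht : EntryLE abv 1 (t : Matrix (Fin 2) (Fin 2) F))
    (ht' : EntryLE abv 1 ((t⁻¹ : GL (Fin 2) F) : Matrix (Fin 2) (Fin 2) F))
    (k : GL (Fin 2) F) (hk : k ∈ congruenceSubgroup abv hna hr0 hr1) :
    t⁻¹ * k * t ∈ congruenceSubgroup abv hna hr0 hr1 := by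
  rw [mem_congruenceSubgroup] at hk ⊢
  have hid : ((t⁻¹ * k * t : GL (Fin 2) F) : Matrix (Fin 2) (Fin 2) F) - 1
      = ((t⁻¹ : GL (Fin 2) F) : Matrix (Fin 2) (Fin 2) F) * ((k : Matrix (Fin 2) (Fin 2) F) - 1)
          * (t : Matrix (Fin 2) (Fin 2) F) := by
    have h1 : ((t⁻¹ : GL (Fin 2) F) : Matrix (Fin 2) (Fin 2) F) * (t : Matrix (Fin 2) (Fin 2) F) = 1 :=
      Units.inv_mul t
    rw [Units.val_mul, Units.val_mul, mul_sub, sub_mul, mul_one, h1]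
  rw [hid]
  have h1 := EntryLE.mul abv hna zero_le_one ht' hk
  rw [one_mul] at h1
  have h2 := EntryLE.mul abv hna hr0 h1 ht
  rw [mul_one] at h2
  exact h2

/-- the `Normalizes` hypothesis of the level tower for any hom into the integral matrices with integral inverses. -/
theorem normalizes_congruenceSubgroup (hna : IsNonarchimedean abv) {B : Type*} [Group B] {r : ℝ} (hr0 : 0 ≤ r) (hr1 : r < 1)
    (ιB : B →* GL (Fin 2) F) (hB : ∀ b, EntryLE abv 1 ((ιB b : GL (Fin 2) F) : Matrix (Fin 2) (Fin 2) F))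
    (hB' : ∀ b, EntryLE abv 1 (((ιB b)⁻¹ : GL (Fin 2) F) : Matrix (Fin 2) (Fin 2) F)) :
    LevelInvariantOrbital.Normalizes ιB (congruenceSubgroup abv hna hr0 hr1) :=
  fun b k hk => normalizes_of_integral abv hna hr0 hr1 (ιB b) (hB b) (hB' b) k hk

/-- **antitone in the radius**. -/
theorem congruenceSubgroup_mono (hna : IsNonarchimedean abv) {r s : ℝ} (hr0 : 0 ≤ r) (hr1 : r < 1) (hs0 : 0 ≤ s) (hs1 : s < 1)
    (hrs : r ≤ s) : congruenceSubgroup abv hna hr0 hr1 ≤ congruenceSubgroup abv hna hs0 hs1 :=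
  fun _ hg => (show EntryLE abv r _ from hg).mono abv hrs

/-- **a tower with radii `→ 0` has intersection `{1}`**. -/
theorem eq_one_of_forall_mem (hna : IsNonarchimedean abv) (r : ℕ → ℝ) (hr0 : ∀ N, 0 ≤ r N) (hr1 : ∀ N, r N < 1)
    (hlim : ∀ ε > 0, ∃ N, r N < ε) (g : GL (Fin 2) F)
    (hg : ∀ N, g ∈ congruenceSubgroup abv hna (hr0 N) (hr1 N)) : g = 1 := by
  have hzero : ∀ i j, ((g : Matrix (Fin 2) (Fin 2) F) - 1) i j = 0 := by
    intro i j
    by_contra hne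
    have hpos : 0 < abv (((g : Matrix (Fin 2) (Fin 2) F) - 1) i j) := abv.pos hne
    obtain ⟨N, hN⟩ := hlim _ hpos
    exact absurd ((show EntryLE abv (r N) _ from hg N) i j) (not_le.2 hN)
  have hsub : (g : Matrix (Fin 2) (Fin 2) F) - 1 = 0 := by
    ext i j
    exact hzero i j
  exact Units.ext (sub_eq_zero.1 hsub)

/-! ## The level tower `K N = K_{q⁻¹ ^ (N+1)}` -/

/-- the radius `q⁻¹ ^ (N + 1)` is non-negative. -/
theorem radius_nonneg {q : ℝ} (hq : 1 < q) (N : ℕ) : 0 ≤ q⁻¹ ^ (N + 1) :=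
  pow_nonneg (inv_nonneg.2 (zero_le_one.trans hq.le)) _

/-- the radius `q⁻¹ ^ (N + 1)` is `< 1`. -/
theorem radius_lt_one {q : ℝ} (hq : 1 < q) (N : ℕ) : q⁻¹ ^ (N + 1) < 1 :=
  pow_lt_one₀ (inv_nonneg.2 (zero_le_one.trans hq.le)) (inv_lt_one_of_one_lt₀ hq) (Nat.succ_ne_zero N)

/-- **the level tower**: `K N := K_{q⁻¹ ^ (N+1)}` (the shift keeps every radius `< 1`). -/
noncomputable def levelTower (hna : IsNonarchimedean abv) {q : ℝ} (hq : 1 < q) (N : ℕ) : Subgroup (GL (Fin 2) F) :=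
  congruenceSubgroup abv hna (radius_nonneg hq N) (radius_lt_one hq N)

/-- the level tower is antitone. -/
theorem levelTower_antitone (hna : IsNonarchimedean abv) {q : ℝ} (hq : 1 < q) : Antitone (levelTower abv hna hq) := by
  intro N M hNM
  apply congruenceSubgroup_mono
  exact pow_le_pow_of_le_one (inv_nonneg.2 (zero_le_one.trans hq.le)) (inv_le_one_of_one_le₀ hq.le)
    (Nat.succ_le_succ hNM)

/-- the level tower is normalised by any hom into the integral matrices with integral inverses. -/
theorem normalizes_levelTower (hna : IsNonarchimedean abv) {B : Type*} [Group B] {q : ℝ} (hq : 1 < q) (ιB : B →* GL (Fin 2) F)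
    (hB : ∀ b, EntryLE abv 1 ((ιB b : GL (Fin 2) F) : Matrix (Fin 2) (Fin 2) F))
    (hB' : ∀ b, EntryLE abv 1 (((ιB b)⁻¹ : GL (Fin 2) F) : Matrix (Fin 2) (Fin 2) F)) (N : ℕ) :
    LevelInvariantOrbital.Normalizes ιB (levelTower abv hna hq N) :=
  normalizes_congruenceSubgroup abv hna _ _ ιB hB hB'

/-- the radii of the level tower tend to `0`. -/
theorem exists_radius_lt {q : ℝ} (hq : 1 < q) {ε : ℝ} (hε : 0 < ε) : ∃ N, q⁻¹ ^ (N + 1) < ε := by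
  have hq0 : 0 < q⁻¹ := inv_pos.2 (zero_lt_one.trans hq)
  have hq1 : q⁻¹ < 1 := inv_lt_one_of_one_lt₀ hq
  obtain ⟨N, hN⟩ := exists_pow_lt_of_lt_one hε hq1
  exact ⟨N, (pow_le_pow_of_le_one hq0.le hq1.le (Nat.le_succ N)).trans_lt hN⟩

/-- **`⋂ K N = {1}`** for the level tower: the `hK1` hypothesis of LevelFactorPositive. -/
theorem eq_one_of_forall_mem_levelTower (hna : IsNonarchimedean abv) {q : ℝ} (hq : 1 < q) (g : GL (Fin 2) F)
    (hg : ∀ N, g ∈ levelTower abv hna hq N) : g = 1 :=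
  eq_one_of_forall_mem abv hna (fun N => q⁻¹ ^ (N + 1)) (radius_nonneg hq) (radius_lt_one hq)
    (fun _ hε => exists_radius_lt hq hε) g hg

end Summit.Ventures.HodgeRepro2.Tier7.Line3.CongruenceSubgroup
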